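import Literature.Geometry.Symplectic.OrigamiNullFoliation
import Literature.Geometry.Kaehler.ManifoldFormsChart
import Literature.Topology.FourManifolds.RegularLevelSet
import Mathlib.Geometry.Manifold.PartitionOfUnity
import HarnessLib

/-!
# The fold of a folded symplectic form on an oriented 4-manifold is a regular level set

Proofs companion of `OrigamiUnfolding.lean` (the named fact
`Literature.Geometry.Symplectic.exists_symplecticCutPieces_of_isOrigamiForm`, Cannas da
Silva–Guillemin–Pires, *Symplectic Origami*, IMRN 2011 = arXiv:0909.4065, Prop. 2.8; architecture
of the printed proof in the module docstring of `OrigamiUnfoldingProofs.lean`, steps (S0)–(S4)).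
Step (S1) of the unfolding — the Moser collar `φ : Z × (-ε, ε) → 𝒰` of the fold (Cannas da
Silva–Guillemin–Woodward 2000, Thm. 1) — and every collar-based variant of it start from a
product neighbourhood of the folding hypersurface `Z`.  In print `Z` is the regular zero set of
`f = ωⁿ / vol` for a volume form (§2.1: "`ωⁿ` vanishes transversally … for oriented `M`,
`M ∖ Z = M⁺ ⊔ M⁻` with `M⁺` where `ωⁿ > 0`"), and the product neighbourhood is that of a
regular level.  The tree's rendering `IsFoldedForm` (`OrigamiForm.lean`) has no volume form: the
transversality clause is stated chart by chart through the chart Pfaffian, and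
`OrigamiUnfoldingProofs.lean` reads the sides `M⁺ = posSide o s`, `M⁻ = posSide (-o) s` off the
sign of the Pfaffian against a smooth orientation `o`.  This file produces the GLOBAL function:

* the signed chart Pfaffian `y ↦ ε(o, x₀) · Pf (s.inChart x₀ (φ_{x₀} y))` at `x₀` (written
  out in each statement) and its chart model `e ↦ ε(o, x₀) · Pf (s.inChart x₀ e)`; it is `C^∞`
  on the chart domain (`contMDiffOn_foldChartFun`, from `IsSmoothForm.contDiffOn_inChart`), vanishes
  there exactly on the fold (`foldChartFun_eq_zero_iff`), near `x₀` it is positive exactly on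
  `M⁺(o)` and negative exactly on `M⁻(o)` (`eventually_foldChartFun_pos_iff`, the chart
  comparison `eventually_orientationSign_mul_pfaffian_inChart`), and near a FOLD point its chart
  model has non-zero derivative (`IsFoldedForm.eventually_fderiv_foldChartModel_ne_zero`:
  `ω ∧ ω ⋔ 0` at the centre plus continuity of the derivative), whence through every nearby
  point a smooth test curve along which it strictly increases
  (`IsFoldedForm.exists_nhds_foldChartFun`);
* `IsFoldedForm.exists_local_definingData` — local defining data at every point (the above at
  fold points, the constants `±1` on the sides);
* **`IsFoldedForm.exists_foldDefiningFunction`** — for a folded form on an oriented (`T₂`,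
  σ-compact) 4-manifold there is a `C^∞` function `f : M → ℝ`, positive exactly on `M⁺(o)`,
  negative exactly on `M⁻(o)`, zero exactly on the fold, with `df ≠ 0` along the fold.  `f` is
  glued from the local data by a smooth partition of unity (Mathlib's
  `SmoothPartitionOfUnity`); the sign properties are convexity; for `df_z ≠ 0` one tests `f`
  along the test curve `γ` of a chart `x₀` carrying positive weight at `z`: the weighted chart
  term `ρ_{x₀} g_{x₀}` has derivative `ρ_{x₀}(z) · c > 0` along `γ`, and the remaining terms sum
  to a function vanishing at `0` and `≥ 0` for small `t > 0` (the curve enters `M⁺`, where every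
  term is `≥ 0`), whose derivative at `0` is therefore `≥ 0` (`deriv_nonneg_of_nonneg_right`);
  `IsOrigamiForm.exists_foldDefiningFunction`, and the packaging
  **`IsFoldedForm.exists_isRegularLevel_fold`**: the fold is the regular level `f⁻¹(0)` in the
  sense of `Literature.IsRegularLevel` (`Topology/FourManifolds/RegularLevelSet.lean`), so that
  the product-collar machinery of `Topology/FourManifolds/RegularLevelCollar.lean` (Milnor's
  `f⁻¹(-δ, δ) ≅ f⁻¹(0) × (-δ, δ)` on a closed manifold) applies to the fold;
* the differential of a defining function along the fold:
  `IsFoldedForm.mfderiv_comp_mfderiv_eq_zero` (`df ∘ dj = 0`),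
  **`IsFoldedForm.ker_mfderiv_eq_range`** (`ker df_{j n} = range dj_n = T_{j n} Z` when
  `df_{j n} ≠ 0`) and `IsFoldedForm.mfderiv_apply_ne_zero_iff` (a tangent vector is transverse
  to the fold iff `df` does not kill it) — the form in which the maximal-rank clause
  `ker ω ⊄ TZ` of `IsFoldedForm` is consumed when the collar is adapted to `ker ω`.

Everything here is proved; no definitions, no named facts (D-0026).

## References

* [CannasdasilvaGuilleminPires2010] A. Cannas da Silva, V. Guillemin, A. R. Pires, *Symplectic
  Origami*, IMRN 2011, 4252–4293 = arXiv:0909.4065, Def. 2.1 and §2.1 (the fold, `M^±`),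
  Prop. 2.8 (unfolding).
* A. Cannas da Silva, V. Guillemin, C. Woodward, *On the unfolding of folded symplectic
  structures*, Math. Res. Lett. 7 (2000) 35–53, Thm. 1 (the collar of the fold).
* J. Milnor, *Lectures on the h-cobordism theorem* (1965), Thm. 3.4 (product neighbourhood of
  a regular level). [MilnorHCobordism1965]
-/

noncomputable section

open scoped Manifold ContDiff Topology
open Set Function Filter
open Literature.Geometry.Kaehler Literature.Topology.FourManifolds

namespace Literature.Geometry.Symplectic

variable {M : Type*} [TopologicalSpace M] [ChartedSpace (EuclideanSpace ℝ (Fin 4)) M]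
  [IsManifold (𝓡 4) ∞ M]

/-! ### The signed chart Pfaffian as a local defining function -/

section Local

/-- The chart model of a smooth form is `C^∞` on the chart target. [folklore] -/
theorem contDiffOn_foldChartModel (o : SmoothOrientation (𝓡 4) M) {s : MForm (𝓡 4) M ℝ 2}
    (hs : IsSmoothForm s) (x₀ : M) :
    ContDiffOn ℝ ∞ (fun e => orientationSign o x₀ * pfaffian (s.inChart x₀ e))
      (extChartAt (𝓡 4) x₀).target :=
  contDiffOn_const.mul (contDiff_pfaffian.comp_contDiffOn
    (Literature.Geometry.Kaehler.IsSmoothForm.contDiffOn_inChart hs x₀))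

/-- The signed chart Pfaffian is `C^∞` on the chart domain. [folklore] -/
theorem contMDiffOn_foldChartFun (o : SmoothOrientation (𝓡 4) M) {s : MForm (𝓡 4) M ℝ 2}
    (hs : IsSmoothForm s) (x₀ : M) :
    ContMDiffOn (𝓡 4) 𝓘(ℝ, ℝ) ∞
      (fun y => orientationSign o x₀ * pfaffian (s.inChart x₀ (extChartAt (𝓡 4) x₀ y)))
      (extChartAt (𝓡 4) x₀).source := by
  have h1 : ContMDiffOn 𝓘(ℝ, EuclideanSpace ℝ (Fin 4)) 𝓘(ℝ, ℝ) ∞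
      (fun e => orientationSign o x₀ * pfaffian (s.inChart x₀ e)) (extChartAt (𝓡 4) x₀).target :=
    (contDiffOn_foldChartModel o hs x₀).contMDiffOn
  have h2 : ContMDiffOn (𝓡 4) 𝓘(ℝ, EuclideanSpace ℝ (Fin 4)) ∞ (extChartAt (𝓡 4) x₀)
      (extChartAt (𝓡 4) x₀).source := by
    rw [extChartAt_source]
    exact contMDiffOn_extChartAt
  exact h1.comp h2 fun y hy => (extChartAt (𝓡 4) x₀).map_source hy

/-- On the chart domain the signed chart Pfaffian vanishes exactly on the fold.
[cite: CannasdasilvaGuilleminPires2010, Def. 2.1] -/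
theorem foldChartFun_eq_zero_iff (o : SmoothOrientation (𝓡 4) M) (s : MForm (𝓡 4) M ℝ 2)
    (x₀ : M) {y : M} (hy : y ∈ (extChartAt (𝓡 4) x₀).source) :
    orientationSign o x₀ * pfaffian (s.inChart x₀ (extChartAt (𝓡 4) x₀ y)) = 0 ↔ y ∈ fold s := by
  rw [mul_eq_zero, mem_fold_iff_pfaffian_inChart s x₀ hy]
  exact ⟨fun h => h.resolve_left (orientationSign_ne_zero o x₀), Or.inr⟩

/-- Near `x₀` the signed chart Pfaffian is positive exactly on `M⁺(o)` and negative exactly on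
`M⁻(o) = M⁺(-o)` (chart comparison of the signed Pfaffian).
[cite: CannasdasilvaGuilleminPires2010, §2.1] -/
theorem eventually_foldChartFun_pos_iff (o : SmoothOrientation (𝓡 4) M) (s : MForm (𝓡 4) M ℝ 2)
    (x₀ : M) :
    ∀ᶠ y in 𝓝 x₀,
      (0 < orientationSign o x₀ * pfaffian (s.inChart x₀ (extChartAt (𝓡 4) x₀ y)) ↔
        y ∈ posSide o s) ∧
      (orientationSign o x₀ * pfaffian (s.inChart x₀ (extChartAt (𝓡 4) x₀ y)) < 0 ↔
        y ∈ posSide (-o) s) := by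
  filter_upwards [eventually_orientationSign_mul_pfaffian_inChart o s x₀] with y hy
  obtain ⟨c, hc, hyc⟩ := hy
  rw [hyc, mem_posSide_iff, mem_posSide_neg_iff]
  refine ⟨mul_pos_iff_of_pos_left hc, ?_⟩
  rw [← neg_pos, ← mul_neg, mul_pos_iff_of_pos_left hc, neg_pos]

variable {N : Type} [TopologicalSpace N] [ChartedSpace (EuclideanSpace ℝ (Fin 3)) N] {j : N → M}

/-- **Transversality persists near a fold point**: the derivative of the chart model is non-zero
at the image of every point near `x₀ ∈ Z` (it is non-zero at the centre by `ω ∧ ω ⋔ 0`, and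
continuous). [cite: CannasdasilvaGuilleminPires2010, Def. 2.1] -/
theorem IsFoldedForm.eventually_fderiv_foldChartModel_ne_zero {s : MForm (𝓡 4) M ℝ 2}
    (h : IsFoldedForm s N j) (o : SmoothOrientation (𝓡 4) M) {x₀ : M} (hx₀ : x₀ ∈ fold s) :
    ∀ᶠ y in 𝓝 x₀, fderiv ℝ (fun e => orientationSign o x₀ * pfaffian (s.inChart x₀ e)) (extChartAt (𝓡 4) x₀ y) ≠ 0 := by
  have hcont : ContinuousOn (fderiv ℝ (fun e => orientationSign o x₀ * pfaffian (s.inChart x₀ e)))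
      (extChartAt (𝓡 4) x₀).target :=
    (contDiffOn_foldChartModel o h.smooth x₀).continuousOn_fderiv_of_isOpen
      (isOpen_extChartAt_target x₀) (by norm_num)
  have h0 : fderiv ℝ (fun e => orientationSign o x₀ * pfaffian (s.inChart x₀ e)) (extChartAt (𝓡 4) x₀ x₀) ≠ 0 := by
    have hT := h.transverse x₀ hx₀
    have hd : DifferentiableAt ℝ (fun e => pfaffian (s.inChart x₀ e))
        (extChartAt (𝓡 4) x₀ x₀) := by
      by_contra hnd
      exact hT (fderiv_zero_of_not_differentiableAt hnd)
    have heq : fderiv ℝ (fun e => orientationSign o x₀ * pfaffian (s.inChart x₀ e)) (extChartAt (𝓡 4) x₀ x₀) =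
        orientationSign o x₀ • fderiv ℝ (fun e => pfaffian (s.inChart x₀ e))
          (extChartAt (𝓡 4) x₀ x₀) :=
      fderiv_const_mul hd _
    rw [heq]
    exact smul_ne_zero (orientationSign_ne_zero o x₀) hT
  have hne : ∀ᶠ e in 𝓝 (extChartAt (𝓡 4) x₀ x₀), fderiv ℝ (fun e => orientationSign o x₀ * pfaffian (s.inChart x₀ e)) e ≠ 0 :=
    (hcont.continuousAt (extChartAt_target_mem_nhds x₀)).eventually_ne h0
  exact (continuousAt_extChartAt x₀).eventually hne

/-- **The signed chart Pfaffian as a local defining function, with a test curve.** Near a fold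
point `x₀` there is an open set `U ∋ x₀` inside the chart domain on which: the signed chart
Pfaffian is positive exactly on `M⁺(o)`, negative exactly on `M⁻(o)` (and zero exactly on the
fold), and through every point `z ∈ U` there is a smooth curve `γ`, `γ 0 = z`, along which it
has POSITIVE derivative at `0` (the straight line in the chart in a direction of positive
derivative, which exists by transversality). [cite: CannasdasilvaGuilleminPires2010, Def. 2.1 and §2.1] -/
theorem IsFoldedForm.exists_nhds_foldChartFun {s : MForm (𝓡 4) M ℝ 2} (h : IsFoldedForm s N j)
    (o : SmoothOrientation (𝓡 4) M) {x₀ : M} (hx₀ : x₀ ∈ fold s) :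
    ∃ U : Set M, IsOpen U ∧ x₀ ∈ U ∧ U ⊆ (extChartAt (𝓡 4) x₀).source ∧
      (∀ y ∈ U,
        (0 < orientationSign o x₀ * pfaffian (s.inChart x₀ (extChartAt (𝓡 4) x₀ y)) ↔
          y ∈ posSide o s) ∧
        (orientationSign o x₀ * pfaffian (s.inChart x₀ (extChartAt (𝓡 4) x₀ y)) < 0 ↔
          y ∈ posSide (-o) s)) ∧
      ∀ z ∈ U, ∃ γ : ℝ → M, γ 0 = z ∧ ContMDiffAt 𝓘(ℝ, ℝ) (𝓡 4) ∞ γ 0 ∧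
        ∃ c : ℝ, 0 < c ∧ HasDerivAt
          (fun t => orientationSign o x₀ * pfaffian (s.inChart x₀ (extChartAt (𝓡 4) x₀ (γ t))))
          c 0 := by
  set G : EuclideanSpace ℝ (Fin 4) → ℝ := fun e => orientationSign o x₀ * pfaffian (s.inChart x₀ e)
    with hG
  set φ := extChartAt (𝓡 4) x₀ with hφ
  have hsrc : ∀ᶠ y in 𝓝 x₀, y ∈ φ.source := extChartAt_source_mem_nhds x₀
  obtain ⟨U, hU, hUo, hxU⟩ := eventually_nhds_iff.1
    (hsrc.and ((eventually_foldChartFun_pos_iff o s x₀).and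
      (h.eventually_fderiv_foldChartModel_ne_zero o hx₀)))
  refine ⟨U, hUo, hxU, fun y hy => (hU y hy).1, fun y hy => (hU y hy).2.1, fun z hz => ?_⟩
  obtain ⟨hzs, -, hT⟩ := hU z hz
  -- `G` is differentiable at `φ z` with non-zero derivative: pick a direction of increase
  have hzt : φ z ∈ φ.target := φ.map_source hzs
  have hGd : DifferentiableAt ℝ G (φ z) := by
    by_contra hnd
    exact hT (fderiv_zero_of_not_differentiableAt hnd)
  obtain ⟨w, hw⟩ : ∃ w, 0 < fderiv ℝ G (φ z) w := by
    obtain ⟨w₀, hw₀⟩ : ∃ w₀, fderiv ℝ G (φ z) w₀ ≠ 0 := by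
      by_contra hall
      push Not at hall
      exact hT (ContinuousLinearMap.ext hall)
    rcases lt_or_gt_of_ne hw₀ with hlt | hgt
    · exact ⟨-w₀, by rw [map_neg]; linarith⟩
    · exact ⟨w₀, hgt⟩
  -- the straight line in the chart
  set ℓ : ℝ → EuclideanSpace ℝ (Fin 4) := fun t => φ z + t • w with hℓ
  have hℓ0 : ℓ 0 = φ z := by simp [hℓ]
  have hℓd : HasDerivAt ℓ w 0 := by
    have := ((hasDerivAt_id (0 : ℝ)).smul_const w).const_add (φ z)
    simpa [hℓ] using this
  have hℓs : ContDiff ℝ ∞ ℓ := by fun_prop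
  have htgt : ∀ᶠ t in 𝓝 (0 : ℝ), ℓ t ∈ φ.target := by
    have : φ.target ∈ 𝓝 (ℓ 0) := hℓ0 ▸ (isOpen_extChartAt_target x₀).mem_nhds hzt
    exact hℓs.continuous.continuousAt.preimage_mem_nhds this
  refine ⟨fun t => φ.symm (ℓ t), by simp only [hℓ0, φ.left_inv hzs], ?_, fderiv ℝ G (φ z) w,
    hw, ?_⟩
  · -- smoothness of the curve at `0`
    have h1 : ContMDiffAt 𝓘(ℝ, EuclideanSpace ℝ (Fin 4)) (𝓡 4) ∞ φ.symm (ℓ 0) := by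
      rw [hℓ0]
      exact (contMDiffOn_extChartAt_symm x₀).contMDiffAt
        ((isOpen_extChartAt_target x₀).mem_nhds hzt)
    exact h1.comp 0 hℓs.contMDiff.contMDiffAt
  · -- derivative along the curve: `foldChartFun ∘ γ = G ∘ ℓ` near `0`
    have heq : (fun t => G (φ (φ.symm (ℓ t)))) =ᶠ[𝓝 0] fun t => G (ℓ t) := by
      filter_upwards [htgt] with t ht
      rw [φ.right_inv ht]
    refine HasDerivAt.congr_of_eventuallyEq ?_ heq
    have h2 : HasFDerivAt G (fderiv ℝ G (φ z)) (ℓ 0) := by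
      rw [hℓ0]
      exact hGd.hasFDerivAt
    exact h2.comp_hasDerivAt 0 hℓd

end Local

/-! ### Local defining data at every point, and the global defining function -/

section Global

variable {N : Type} [TopologicalSpace N] [ChartedSpace (EuclideanSpace ℝ (Fin 3)) N] {j : N → M}

/-- **Local defining data** at a point `x`: an open set `U ∋ x` and a function `g`, `C^∞` on `U`,
which on `U` is positive exactly on `M⁺(o)` and negative exactly on `M⁻(o)`, and which at every
FOLD point of `U` increases (with positive derivative) along some smooth curve. At a fold point
this is the signed chart Pfaffian (`IsFoldedForm.exists_nhds_foldChartFun`); at a point of a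
side it is the constant `±1` on that side. [cite: CannasdasilvaGuilleminPires2010, §2.1] -/
theorem IsFoldedForm.exists_local_definingData {s : MForm (𝓡 4) M ℝ 2} (h : IsFoldedForm s N j)
    (o : SmoothOrientation (𝓡 4) M) (x : M) :
    ∃ (U : Set M) (g : M → ℝ), IsOpen U ∧ x ∈ U ∧ ContMDiffOn (𝓡 4) 𝓘(ℝ, ℝ) ∞ g U ∧
      (∀ y ∈ U, (0 < g y ↔ y ∈ posSide o s) ∧ (g y < 0 ↔ y ∈ posSide (-o) s)) ∧
      ∀ z ∈ U, z ∈ fold s → ∃ γ : ℝ → M, γ 0 = z ∧ ContMDiffAt 𝓘(ℝ, ℝ) (𝓡 4) ∞ γ 0 ∧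
        ∃ c : ℝ, 0 < c ∧ HasDerivAt (fun t => g (γ t)) c 0 := by
  by_cases hx : x ∈ fold s
  · obtain ⟨U, hUo, hxU, hUs, hsign, hcurve⟩ := h.exists_nhds_foldChartFun o hx
    exact ⟨U, fun y => orientationSign o x * pfaffian (s.inChart x (extChartAt (𝓡 4) x y)), hUo,
      hxU, (contMDiffOn_foldChartFun o h.smooth x).mono hUs, hsign, fun z hz _ => hcurve z hz⟩
  · have hx' : x ∈ posSide o s ∪ posSide (-o) s := by
      rw [posSide_union_posSide_neg]; exact hx
    have hdisj := disjoint_posSide_posSide_neg o s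
    have hZ : ∀ (o' : SmoothOrientation (𝓡 4) M), ∀ z ∈ posSide o' s, z ∉ fold s := by
      intro o' z hz hzf
      have := Set.eq_empty_iff_forall_notMem.1 (fold_inter_posSide o' s) z
      exact this ⟨hzf, hz⟩
    rcases hx' with hx' | hx'
    · refine ⟨posSide o s, fun _ => 1, isOpen_posSide o h.smooth, hx', contMDiffOn_const,
        fun y hy => ⟨⟨fun _ => hy, fun _ => one_pos⟩, ⟨fun h1 => absurd h1 (by norm_num),
          fun hy' => absurd hy' (Set.disjoint_left.1 hdisj hy)⟩⟩,
        fun z hz hzf => absurd hzf (hZ o z hz)⟩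
    · refine ⟨posSide (-o) s, fun _ => -1, isOpen_posSide (-o) h.smooth, hx', contMDiffOn_const,
        fun y hy => ⟨⟨fun h1 => absurd h1 (by norm_num),
          fun hy' => absurd hy (Set.disjoint_left.1 hdisj hy')⟩, ⟨fun _ => hy, fun _ => by norm_num⟩⟩,
        fun z hz hzf => absurd hzf (hZ (-o) z hz)⟩

/-- One-sided first-order comparison: a real function, differentiable at `0`, vanishing at `0`
and non-negative to the right of `0`, has non-negative derivative at `0`. [folklore] -/
theorem deriv_nonneg_of_nonneg_right {φ : ℝ → ℝ} {d : ℝ} (hφ : HasDerivAt φ d 0) (h0 : φ 0 = 0)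
    (hpos : ∀ᶠ t in 𝓝[>] (0 : ℝ), 0 ≤ φ t) : 0 ≤ d := by
  have ht : Tendsto (fun t => t⁻¹ • (φ (0 + t) - φ 0)) (𝓝[>] 0) (𝓝 d) := by
    have := (hasDerivAt_iff_tendsto_slope_zero.1 hφ)
    exact this.mono_left (nhdsWithin_mono _ fun t (ht : 0 < t) => ne_of_gt ht)
  refine ge_of_tendsto ht ?_
  filter_upwards [hpos, self_mem_nhdsWithin] with t hφt (ht : 0 < t)
  rw [zero_add, h0, sub_zero, smul_eq_mul]
  exact mul_nonneg (inv_nonneg.2 ht.le) hφt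

variable [T2Space M] [SigmaCompactSpace M]

/-- **A global defining function of the fold of a folded symplectic form on an oriented
4-manifold.** For a folded form `ω` (Def. 2.1) on an oriented `M` there is a `C^∞` function
`f : M → ℝ` which is positive exactly on `M⁺ = {ω² > 0}`, negative exactly on `M⁻ = {ω² < 0}`,
zero exactly on the fold `Z`, and has NON-ZERO differential at every fold point — so that `Z` is
the regular level `f⁻¹(0)` and `M^± = {±f > 0}` (§2.1: "`ωⁿ` vanishes transversally on `Z` … for
oriented `M`, `M ∖ Z = M⁺ ⊔ M⁻`"; in print `f = ωⁿ/vol` for a volume form, here `f` is glued from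
the signed chart Pfaffians by a smooth partition of unity, its differential at a fold point being
positive along the test curve of one chart and non-negative along it for all others, because
every signed chart Pfaffian is positive on `M⁺`).
[cite: CannasdasilvaGuilleminPires2010, Def. 2.1 and §2.1] -/
theorem IsFoldedForm.exists_foldDefiningFunction {s : MForm (𝓡 4) M ℝ 2} (h : IsFoldedForm s N j)
    (o : SmoothOrientation (𝓡 4) M) :
    ∃ f : M → ℝ, ContMDiff (𝓡 4) 𝓘(ℝ, ℝ) ∞ f ∧
      (∀ x, 0 < f x ↔ x ∈ posSide o s) ∧ (∀ x, f x < 0 ↔ x ∈ posSide (-o) s) ∧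
      (∀ x, f x = 0 ↔ x ∈ fold s) ∧ ∀ x ∈ fold s, mfderiv (𝓡 4) 𝓘(ℝ, ℝ) f x ≠ 0 := by
  classical
  -- local data at every point
  choose U g hUo hxU hg hsign hcurve using h.exists_local_definingData o
  -- a smooth partition of unity subordinate to the cover `U`
  obtain ⟨ρ, hρ⟩ := SmoothPartitionOfUnity.exists_isSubordinate (ι := M) (I := 𝓡 4) (M := M)
    isClosed_univ U hUo (fun x _ => mem_iUnion.2 ⟨x, hxU x⟩)
  set f : M → ℝ := fun y => ∑ᶠ x, ρ x y • g x y with hf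
  have hmemU : ∀ {x y : M}, ρ x y ≠ 0 → y ∈ U x := fun {x y} hxy =>
    hρ x (subset_tsupport _ (mem_support.2 hxy))
  -- smoothness
  have hfs : ContMDiff (𝓡 4) 𝓘(ℝ, ℝ) ∞ f := hρ.contMDiff_finsum_smul hUo hg
  -- sign properties, by convexity of the three target sets
  have hpos : ∀ y ∈ posSide o s, 0 < f y := fun y hy =>
    ρ.finsum_smul_mem_convex (t := Ioi (0 : ℝ)) (mem_univ y)
      (fun x hx => ((hsign x y (hmemU hx)).1).2 hy) (convex_Ioi 0)
  have hneg : ∀ y ∈ posSide (-o) s, f y < 0 := fun y hy =>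
    ρ.finsum_smul_mem_convex (t := Iio (0 : ℝ)) (mem_univ y)
      (fun x hx => ((hsign x y (hmemU hx)).2).2 hy) (convex_Iio 0)
  have hgz : ∀ {x z : M}, z ∈ U x → z ∈ fold s → g x z = 0 := by
    intro x z hz hzf
    rcases lt_trichotomy (g x z) 0 with hlt | heq | hgt
    · exact absurd hzf (by
        have hz' := ((hsign x z hz).2).1 hlt
        have := Set.eq_empty_iff_forall_notMem.1 (fold_inter_posSide (-o) s) z
        exact fun hzf => this ⟨hzf, hz'⟩)
    · exact heq
    · exact absurd hzf (by
        have hz' := ((hsign x z hz).1).1 hgt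
        have := Set.eq_empty_iff_forall_notMem.1 (fold_inter_posSide o s) z
        exact fun hzf => this ⟨hzf, hz'⟩)
  have hzero : ∀ z ∈ fold s, f z = 0 := fun z hz =>
    ρ.finsum_smul_mem_convex (t := ({0} : Set ℝ)) (mem_univ z)
      (fun x hx => mem_singleton_iff.2 (hgz (hmemU hx) hz)) (convex_singleton 0)
  -- trichotomy of position
  have htri : ∀ y : M, y ∈ fold s ∨ y ∈ posSide o s ∨ y ∈ posSide (-o) s := by
    intro y
    by_cases hy : y ∈ fold s
    · exact Or.inl hy
    · have : y ∈ posSide o s ∪ posSide (-o) s := by rw [posSide_union_posSide_neg]; exact hy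
      exact Or.inr this
  refine ⟨f, hfs, fun y => ⟨fun hy => ?_, hpos y⟩, fun y => ⟨fun hy => ?_, hneg y⟩,
    fun y => ⟨fun hy => ?_, hzero y⟩, fun z hz => ?_⟩
  · rcases htri y with h' | h' | h'
    · exact absurd (hzero y h') hy.ne'
    · exact h'
    · exact absurd hy (not_lt.2 (hneg y h').le)
  · rcases htri y with h' | h' | h'
    · exact absurd (hzero y h') hy.ne
    · exact absurd hy (not_lt.2 (hpos y h').le)
    · exact h'
  · rcases htri y with h' | h' | h'
    · exact h'
    · exact absurd hy (hpos y h').ne'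
    · exact absurd hy (hneg y h').ne
  -- the differential at a fold point is non-zero: test it along the curve of a chart carrying
  -- positive weight at `z`
  obtain ⟨x₀, hx₀⟩ := ρ.exists_pos_of_mem (mem_univ z)
  have hzU : z ∈ U x₀ := hmemU hx₀.ne'
  obtain ⟨γ, hγ0, hγs, c, hc, hγd⟩ := hcurve x₀ z hzU hz
  -- the pieces `t ↦ f (γ t)`, `t ↦ ρ x₀ (γ t)`, `t ↦ g x₀ (γ t)` are differentiable at `0`
  have hfγ : ContMDiffAt 𝓘(ℝ, ℝ) 𝓘(ℝ, ℝ) ∞ (fun t => f (γ t)) 0 :=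
    hfs.contMDiffAt.comp 0 hγs
  have hργ : ContMDiffAt 𝓘(ℝ, ℝ) 𝓘(ℝ, ℝ) ∞ (fun t => ρ x₀ (γ t)) 0 :=
    (ρ x₀).contMDiff.contMDiffAt.comp 0 hγs
  have hfγd : DifferentiableAt ℝ (fun t => f (γ t)) 0 :=
    (contMDiffAt_iff_contDiffAt.1 hfγ).differentiableAt (by norm_num)
  have hργd : DifferentiableAt ℝ (fun t => ρ x₀ (γ t)) 0 :=
    (contMDiffAt_iff_contDiffAt.1 hργ).differentiableAt (by norm_num)
  set D := deriv (fun t => f (γ t)) 0 with hD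
  have hfD : HasDerivAt (fun t => f (γ t)) D 0 := hfγd.hasDerivAt
  -- the weighted chart term `ψ t = ρ x₀ (γ t) * g x₀ (γ t)` has derivative `ρ x₀ z * c > 0`
  have hgz0 : g x₀ (γ 0) = 0 := by rw [hγ0]; exact hgz hzU hz
  have hψ : HasDerivAt (fun t => ρ x₀ (γ t) * g x₀ (γ t)) (ρ x₀ z * c) 0 := by
    have := hργd.hasDerivAt.mul hγd
    rw [hgz0, mul_zero, zero_add, hγ0] at this
    exact this
  -- the remainder `φ = f ∘ γ - ψ` is `≥ 0` to the right of `0` and vanishes at `0`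
  have hφ : HasDerivAt (fun t => f (γ t) - ρ x₀ (γ t) * g x₀ (γ t)) (D - ρ x₀ z * c) 0 :=
    hfD.sub hψ
  have hφ0 : (fun t => f (γ t) - ρ x₀ (γ t) * g x₀ (γ t)) 0 = 0 := by
    show f (γ 0) - ρ x₀ (γ 0) * g x₀ (γ 0) = 0
    rw [hgz0, mul_zero, sub_zero, hγ0]
    exact hzero z hz
  -- to the right of `0` the curve runs in `M⁺ ∩ U x₀`, where every term of `f` is `≥ 0`
  have hγc : ContinuousAt γ 0 := hγs.continuousAt
  have hUx : ∀ᶠ t in 𝓝 (0 : ℝ), γ t ∈ U x₀ :=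
    hγc.preimage_mem_nhds ((hUo x₀).mem_nhds (hγ0 ▸ hzU))
  have hgpos : ∀ᶠ t in 𝓝[>] (0 : ℝ), 0 < g x₀ (γ t) := by
    have ht : Tendsto (fun t => t⁻¹ • (g x₀ (γ (0 + t)) - g x₀ (γ 0))) (𝓝[>] 0) (𝓝 c) :=
      (hasDerivAt_iff_tendsto_slope_zero.1 hγd).mono_left
        (nhdsWithin_mono _ fun t (ht : 0 < t) => ne_of_gt ht)
    filter_upwards [ht.eventually (Ioi_mem_nhds hc), self_mem_nhdsWithin] with t hts (htp : 0 < t)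
    rw [zero_add, hgz0, sub_zero, smul_eq_mul] at hts
    exact (mul_pos_iff_of_pos_left (inv_pos.2 htp)).1 hts
  have hside : ∀ᶠ t in 𝓝[>] (0 : ℝ), γ t ∈ posSide o s := by
    filter_upwards [hgpos, nhdsWithin_le_nhds hUx] with t hgt hUt
    exact ((hsign x₀ (γ t) hUt).1).1 hgt
  have hterm : ∀ y ∈ posSide o s, ∀ x, 0 ≤ ρ x y • g x y := by
    intro y hy x
    by_cases hxy : ρ x y = 0
    · rw [hxy, zero_smul]
    · exact smul_nonneg (ρ.nonneg x y) (((hsign x y (hmemU hxy)).1).2 hy).le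
  have hφpos : ∀ᶠ t in 𝓝[>] (0 : ℝ), 0 ≤ f (γ t) - ρ x₀ (γ t) * g x₀ (γ t) := by
    filter_upwards [hside] with t ht
    rw [sub_nonneg]
    have hfin : (support fun x => ρ x (γ t) • g x (γ t)).Finite :=
      (ρ.locallyFinite.point_finite (γ t)).subset fun x hx => by
        simp only [mem_support, ne_eq, smul_eq_mul, mul_eq_zero, not_or] at hx
        exact mem_support.2 hx.1
    exact single_le_finsum x₀ hfin (hterm (γ t) ht)
  have hineq : 0 ≤ D - ρ x₀ z * c := deriv_nonneg_of_nonneg_right hφ hφ0 hφpos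
  have hDpos : 0 < D := by nlinarith [mul_pos hx₀ hc]
  -- hence `df_z ≠ 0` (else `D = df_z (γ' 0) = 0`)
  intro hzero'
  have hmf : HasMFDerivAt 𝓘(ℝ, ℝ) 𝓘(ℝ, ℝ) (fun t => f (γ t)) 0
      ((mfderiv (𝓡 4) 𝓘(ℝ, ℝ) f z).comp (mfderiv 𝓘(ℝ, ℝ) (𝓡 4) γ 0)) := by
    have h1 : HasMFDerivAt (𝓡 4) 𝓘(ℝ, ℝ) f (γ 0) (mfderiv (𝓡 4) 𝓘(ℝ, ℝ) f z) := by
      rw [hγ0]; exact (hfs.mdifferentiableAt (by norm_num)).hasMFDerivAt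
    have h2 : HasMFDerivAt 𝓘(ℝ, ℝ) (𝓡 4) γ 0 (mfderiv 𝓘(ℝ, ℝ) (𝓡 4) γ 0) :=
      (hγs.mdifferentiableAt (by norm_num)).hasMFDerivAt
    exact h1.comp 0 h2
  rw [hzero', ContinuousLinearMap.zero_comp] at hmf
  have h3 : HasFDerivAt (fun t => f (γ t)) (0 : ℝ →L[ℝ] ℝ) 0 := hasMFDerivAt_iff_hasFDerivAt.1 hmf
  have hD0 : HasDerivAt (fun t => f (γ t)) 0 0 := by simpa using h3.hasDerivAt
  exact hDpos.ne' (hfD.unique hD0)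

/-- The origami version: an origami form on an oriented (`T₂`, σ-compact) 4-manifold has a
global defining function of its fold with the sides as signs.
[cite: CannasdasilvaGuilleminPires2010, Def. 2.2 and §2.1] -/
theorem IsOrigamiForm.exists_foldDefiningFunction {s : MForm (𝓡 4) M ℝ 2} (hs : IsOrigamiForm s)
    (o : SmoothOrientation (𝓡 4) M) :
    ∃ f : M → ℝ, ContMDiff (𝓡 4) 𝓘(ℝ, ℝ) ∞ f ∧
      (∀ x, 0 < f x ↔ x ∈ posSide o s) ∧ (∀ x, f x < 0 ↔ x ∈ posSide (-o) s) ∧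
      (∀ x, f x = 0 ↔ x ∈ fold s) ∧ ∀ x ∈ fold s, mfderiv (𝓡 4) 𝓘(ℝ, ℝ) f x ≠ 0 := by
  obtain ⟨N, _, _, _, _, j, hf⟩ := hs.exists_isFoldedForm
  exact hf.exists_foldDefiningFunction o

/-- **The fold is a regular level.** Packaging for the tree's regular-level / product-collar
machinery (`Literature.IsRegularLevel`, `RegularLevelSet.lean`, `RegularLevelCollar.lean`): the
fold of a folded form on an oriented 4-manifold is the regular zero level of a smooth function
whose sign is the side. [cite: CannasdasilvaGuilleminPires2010, Def. 2.1 and §2.1] -/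
theorem IsFoldedForm.exists_isRegularLevel_fold {s : MForm (𝓡 4) M ℝ 2} (h : IsFoldedForm s N j)
    (o : SmoothOrientation (𝓡 4) M) :
    ∃ f : M → ℝ, IsRegularLevel (𝓡 4) f 0 ∧ f ⁻¹' {0} = fold s ∧
      {x | 0 < f x} = posSide o s ∧ {x | f x < 0} = posSide (-o) s := by
  obtain ⟨f, hfs, hpos, hneg, hzero, hreg⟩ := h.exists_foldDefiningFunction o
  refine ⟨f, ⟨hfs, fun x _ => BoundarylessManifold.isInteriorPoint, fun x hx => ?_⟩,
    Set.ext fun x => hzero x, Set.ext fun x => hpos x, Set.ext fun x => hneg x⟩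
  exact hreg x ((hzero x).1 hx)

end Global

/-! ### The differential of a defining function along the fold -/

section Kernel

variable {N : Type} [TopologicalSpace N] [ChartedSpace (EuclideanSpace ℝ (Fin 3)) N]
  [IsManifold (𝓡 3) ∞ N] {j : N → M}

omit [IsManifold (𝓡 4) ∞ M] [IsManifold (𝓡 3) ∞ N] in
/-- A function vanishing on the fold has differential killing the tangent space of the fold:
`df_{j n} ∘ dj_n = 0` (chain rule for `f ∘ j = 0`). [folklore] -/
theorem IsFoldedForm.mfderiv_comp_mfderiv_eq_zero {s : MForm (𝓡 4) M ℝ 2} (h : IsFoldedForm s N j)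
    {f : M → ℝ} (hf : MDifferentiable (𝓡 4) 𝓘(ℝ, ℝ) f) (hf0 : ∀ x ∈ fold s, f x = 0) (n : N) :
    (mfderiv (𝓡 4) 𝓘(ℝ, ℝ) f (j n)).comp (mfderiv (𝓡 3) (𝓡 4) j n) = 0 := by
  have hj : MDifferentiableAt (𝓡 3) (𝓡 4) j n :=
    (h.embedding.contMDiff.mdifferentiableAt (by norm_num))
  have hcomp := (mfderiv_comp n (hf (j n)) hj).symm
  have hconst : f ∘ j = fun _ => (0 : ℝ) := by
    funext m
    exact hf0 (j m) (h.range_eq ▸ mem_range_self m)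
  rw [hcomp, hconst]
  exact mfderiv_const

omit [IsManifold (𝓡 4) ∞ M] [IsManifold (𝓡 3) ∞ N] in
/-- Hence `df_{j n}` vanishes on tangent vectors of the fold. [folklore] -/
theorem IsFoldedForm.mfderiv_apply_mfderiv_eq_zero {s : MForm (𝓡 4) M ℝ 2}
    (h : IsFoldedForm s N j) {f : M → ℝ} (hf : MDifferentiable (𝓡 4) 𝓘(ℝ, ℝ) f)
    (hf0 : ∀ x ∈ fold s, f x = 0) (n : N) (v : TangentSpace (𝓡 3) n) :
    mfderiv (𝓡 4) 𝓘(ℝ, ℝ) f (j n) (mfderiv (𝓡 3) (𝓡 4) j n v) = 0 := by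
  have h1 := h.mfderiv_comp_mfderiv_eq_zero hf hf0 n
  have h2 : ((mfderiv (𝓡 4) 𝓘(ℝ, ℝ) f (j n)).comp (mfderiv (𝓡 3) (𝓡 4) j n)) v = 0 := by
    rw [h1]; rfl
  exact h2

/-- **The kernel of the differential of a defining function at a fold point is exactly the
tangent space of the fold** (`range dj_n ⊆ ker df_{j n}`, both of dimension `3` when
`df_{j n} ≠ 0`). [folklore] -/
theorem IsFoldedForm.ker_mfderiv_eq_range {s : MForm (𝓡 4) M ℝ 2} (h : IsFoldedForm s N j)
    {f : M → ℝ} (hf : MDifferentiable (𝓡 4) 𝓘(ℝ, ℝ) f) (hf0 : ∀ x ∈ fold s, f x = 0) (n : N)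
    (hn : mfderiv (𝓡 4) 𝓘(ℝ, ℝ) f (j n) ≠ 0) :
    LinearMap.ker (mfderiv (𝓡 4) 𝓘(ℝ, ℝ) f (j n)).toLinearMap =
      LinearMap.range (mfderiv (𝓡 3) (𝓡 4) j n).toLinearMap := by
  -- `range dj ≤ ker df`
  have hle : LinearMap.range (mfderiv (𝓡 3) (𝓡 4) j n).toLinearMap ≤
      LinearMap.ker (mfderiv (𝓡 4) 𝓘(ℝ, ℝ) f (j n)).toLinearMap := by
    rintro _ ⟨v, rfl⟩
    exact h.mfderiv_apply_mfderiv_eq_zero hf hf0 n v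
  -- `df` is onto `ℝ`, so `dim ker df = 3 = dim range dj`
  obtain ⟨v, hv⟩ : ∃ v, mfderiv (𝓡 4) 𝓘(ℝ, ℝ) f (j n) v ≠ 0 := by
    by_contra hall
    push Not at hall
    exact hn (ContinuousLinearMap.ext hall)
  have hker : Module.finrank ℝ (LinearMap.ker (mfderiv (𝓡 4) 𝓘(ℝ, ℝ) f (j n)).toLinearMap) = 3 := by
    let L : EuclideanSpace ℝ (Fin 4) →ₗ[ℝ] ℝ := (mfderiv (𝓡 4) 𝓘(ℝ, ℝ) f (j n)).toLinearMap
    let v' : EuclideanSpace ℝ (Fin 4) := v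
    have hv' : L v' ≠ 0 := hv
    have hsurj : LinearMap.range L = ⊤ := by
      refine eq_top_iff.2 fun r _ => ⟨(r / L v') • v', ?_⟩
      rw [L.map_smul, smul_eq_mul, div_mul_cancel₀ r hv']
    have h1 := LinearMap.finrank_range_add_finrank_ker L
    rw [hsurj, finrank_top, Module.finrank_self, finrank_euclideanSpace_fin] at h1
    have h3 : Module.finrank ℝ (LinearMap.ker L) = 3 := by omega
    exact h3
  symm
  apply Submodule.eq_of_le_of_finrank_eq hle
  rw [h.finrank_range_mfderiv n]
  exact hker.symm

/-- So a defining function detects transversality: at a fold point where `df ≠ 0`, a tangent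
vector `v` of `M` is transverse to the fold iff `df (v) ≠ 0`. [folklore] -/
theorem IsFoldedForm.mfderiv_apply_ne_zero_iff {s : MForm (𝓡 4) M ℝ 2} (h : IsFoldedForm s N j)
    {f : M → ℝ} (hf : MDifferentiable (𝓡 4) 𝓘(ℝ, ℝ) f) (hf0 : ∀ x ∈ fold s, f x = 0) (n : N)
    (hn : mfderiv (𝓡 4) 𝓘(ℝ, ℝ) f (j n) ≠ 0) (v : TangentSpace (𝓡 4) (j n)) :
    mfderiv (𝓡 4) 𝓘(ℝ, ℝ) f (j n) v ≠ 0 ↔ v ∉ Set.range (mfderiv (𝓡 3) (𝓡 4) j n) := by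
  have hk := h.ker_mfderiv_eq_range hf hf0 n hn
  have : v ∈ LinearMap.ker (mfderiv (𝓡 4) 𝓘(ℝ, ℝ) f (j n)).toLinearMap ↔
      v ∈ LinearMap.range (mfderiv (𝓡 3) (𝓡 4) j n).toLinearMap := by rw [hk]
  rw [LinearMap.mem_ker, LinearMap.mem_range] at this
  simp only [ContinuousLinearMap.coe_coe] at this
  rw [Ne, this, Set.mem_range]

end Kernel

end Literature.Geometry.Symplectic

end
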